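/-
Copyright (c) 2026. All rights reserved.
Released under Apache 2.0 license as described in the file LICENSE.
-/
import Summits.AtomisticToContinuum.Crystallization.Theorems.ChartedZeroExcessLayeredLatticeLiouvilleVH

/-!
# ChartedZeroExcessLayeredLatticeLiouville — part VI «ChainBlock»: the in-plane-summed inter-layer kernel of a laminate and the 1D CHAIN EQUATION
  (decomp-a2c-lens-2, g57; helper of stmt-AtomisticToContinuum-26636, leaf (LD′) `ModalLipschitzZ` ⟹ (LD) `LinearExcessDecayZ`; first typed object of brick (b1), critic row 915)

The remaining content of (LD′) (memo NODE-g57i §3) is ONE object: the CROSS-LAYER (conormal) block of the truncated linearised operator of a certified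
laminate — a banded, translation-invariant, self-adjoint-by-blocks 1D CHAIN operator acting on LAYER PROFILES `c : ℤ → E3`.  This file TYPES it and
proves its algebra (no coercivity yet — that transfer, `chainCoercive_of_coerciveZ`, is brick (b1) proper):

* `chainK ϱ a b w X β u := ∑ᶠ γ', nearK ϱ a b w X (γ', β) u` — the in-plane-summed truncated kernel from the site `X` to the layer `β`, applied to `u`
  (a `finsum`; hypothesis-free definition);
* `nearK_translate` / ★ `chainK_translate : chainK ϱ a b w (γ, α) β u = chainK ϱ a b w (0, α) β u` — IN-PLANE TRANSLATION INVARIANCE (the block depends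
  on the layer pair only: the laminate's in-plane lattice symmetry, no hypothesis);
* `chainK_eq_sum` — the finite-sum form over any finset containing the `ϱ`-near sites (co-Lipschitz crystals: `finite_near_lsite`);
* ★ `chainK_eq_zero_of_far (hL : IsLayeredCrystal c a b w) (h : ϱ < c * |β − X.2|) : chainK ϱ a b w X β u = 0` — the chain is BANDED with band
  width `ϱ / c` (co-Lipschitz only; no tameness);
* `chainK_add` / `chainK_smul` / `chainK_swap` — linearity in `u` and the BLOCK SYMMETRY `chainK (γ, α) β = chainK (γ', β) α` (bond reversal `nearK_comm`
  + translation);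
* ★ `truncResidual_layerField_eq_sum` — for a LAYER-ONLY field `φ γ α = c α` the truncated residual at `X` is the CHAIN RESIDUAL
  `Σ_β chainK X β (c β − c X.2)` (fiberwise summation over layers), hence in-plane constant (`truncResidual_layerField_translate`);
* ★ `isTruncHarmonicZ_layerField_iff` — a layer-only field is truncated-harmonic EVERYWHERE iff its profile solves the 1D CHAIN EQUATION
  `∀ α, Σ_β chainK (0, α) β (c β − c α) = 0` (stated with the finite layer window `layerWindow`): the zero-slope members of the mode family of
  `isTruncMode_of_profile` (part VH) are exactly the Lipschitz solutions of a banded second-order-type recursion — the object brick (3) (mode extraction)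
  solves and brick (b1) makes coercive;
* `cutProfile B cf` (the profile cut off to an in-plane cell set) with ★ `row_nearFam_cutProfile_eq` (DEEP-ROW IDENTITY: the row of the truncated quadratic
  form `Σ_q nearFam` at a site whose near sites lie over the cut IS the chain row `Σ_β ⟪cf β − cf α, chainK · β (cf β − cf α)⟫` — the `O(L²)` term of the
  coercivity transfer (b1)), `nearFam_cutProfile_eq_zero` (far rows vanish) and `abs_row_nearFam_le` (collar rows ≤ kernel row-sum — the `O(L)` term).

All statements are over existing declarations (`nearK`, `truncResidual`, `IsTruncHarmonicZ`, `lsite`, `IsLayeredCrystal`, `idxNorm`); complete proofs.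
-/

namespace Summit.AtomisticToContinuum.Crystallization.Theorems.ChartedZeroExcessLayeredLatticeLiouville

open Summit.AtomisticToContinuum.Crystallization.Theorems.ChartedPlanarOrderRigidityDoor (E3)
open Finset
open scoped InnerProductSpace RealInnerProductSpace BigOperators

noncomputable section ChainBlock

variable {c : ℝ} {a b : E3} {w : ℤ → E3}

/-! ### VI.1  The chain block and its in-plane translation invariance -/

/-- the IN-PLANE-SUMMED truncated kernel from the index site `X` to the layer `β`, applied to `u ∈ E3`: `Σ_{γ'} nearK X (γ', β) u` (a finitely supported
sum for co-Lipschitz crystals, `chainK_eq_sum`). [this file, g57] -/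
def chainK (ϱ : ℝ) (a b : E3) (w : ℤ → E3) (X : Cell 2 × ℤ) (β : ℤ) (u : E3) : E3 :=
  ∑ᶠ γ' : Cell 2, nearK ϱ a b w X (γ', β) u

/-- model bond vectors are in-plane translation invariant. [formal bookkeeping] -/
theorem lsite_sub_translate (a b : E3) (w : ℤ → E3) (γ γ' : Cell 2) (α β : ℤ) :
    lsite a b w γ' β - lsite a b w γ α = lsite a b w (γ' - γ) β - lsite a b w 0 α := by
  simp only [lsite, Pi.sub_apply, Int.cast_sub, sub_smul, Pi.zero_apply, Int.cast_zero, zero_smul, zero_add]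
  abel

/-- the truncated kernel is in-plane translation invariant. [this file, g57] -/
theorem nearK_translate (ϱ : ℝ) (a b : E3) (w : ℤ → E3) (γ γ' : Cell 2) (α β : ℤ) (u : E3) :
    nearK ϱ a b w (γ, α) (γ', β) u = nearK ϱ a b w (0, α) (γ' - γ, β) u := by
  unfold nearK
  rw [lsite_sub_translate a b w γ γ' α β, sub_zero]

/-- ★ IN-PLANE TRANSLATION INVARIANCE of the chain block: it depends on the layer pair `(α, β)` only. [this file, g57] -/
theorem chainK_translate (ϱ : ℝ) (a b : E3) (w : ℤ → E3) (γ : Cell 2) (α β : ℤ) (u : E3) :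
    chainK ϱ a b w (γ, α) β u = chainK ϱ a b w (0, α) β u := by
  unfold chainK
  rw [← finsum_comp_equiv (Equiv.subRight γ).symm (f := fun γ' : Cell 2 => nearK ϱ a b w (γ, α) (γ', β) u)]
  refine finsum_congr fun δ => ?_
  rw [nearK_translate]
  congr 2
  simp [Equiv.subRight]

/-! ### VI.2  Finite-sum form and the band -/

/-- a vanishing-criterion for `nearK`: bonds longer than `ϱ` in the model carry no kernel. [formal bookkeeping] -/
theorem nearK_eq_zero_of_lt {ϱ : ℝ} {X Y : Cell 2 × ℤ} (h : ϱ < ‖lsite a b w Y.1 Y.2 - lsite a b w X.1 X.2‖) (u : E3) :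
    nearK ϱ a b w X Y u = 0 := by
  unfold nearK
  exact if_pos h

/-- the chain block as a FINITE sum over the `β`-fibre of any finset containing the `ϱ`-near sites of `X`. [this file, g57] -/
theorem chainK_eq_sum {ϱ : ℝ} {X : Cell 2 × ℤ} {N : Finset (Cell 2 × ℤ)}
    (hN : ∀ Y : Cell 2 × ℤ, ‖lsite a b w Y.1 Y.2 - lsite a b w X.1 X.2‖ ≤ ϱ → Y ∈ N) (β : ℤ) (u : E3) :
    chainK ϱ a b w X β u = ∑ Y ∈ N with Y.2 = β, nearK ϱ a b w X Y u := by
  have hsupp : (Function.support fun γ' : Cell 2 => nearK ϱ a b w X (γ', β) u) ⊆ ((N.filter fun Y => Y.2 = β).image Prod.fst : Finset (Cell 2)) := by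
    intro γ' hγ'
    rw [Function.mem_support] at hγ'
    have hle : ‖lsite a b w γ' β - lsite a b w X.1 X.2‖ ≤ ϱ := not_lt.mp fun h => hγ' (nearK_eq_zero_of_lt (X := X) (Y := (γ', β)) h u)
    rw [coe_image, coe_filter]
    exact ⟨(γ', β), ⟨hN (γ', β) hle, rfl⟩, rfl⟩
  have hinj : Set.InjOn Prod.fst ((N.filter fun Y => Y.2 = β : Finset (Cell 2 × ℤ)) : Set (Cell 2 × ℤ)) := by
    intro Y hY Y' hY' h
    rw [coe_filter] at hY hY'
    exact Prod.ext h (hY.2.trans hY'.2.symm)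
  rw [chainK, finsum_eq_sum_of_support_subset _ hsupp, sum_image hinj]
  refine sum_congr rfl fun Y hY => ?_
  have hY2 : Y.2 = β := (mem_filter.mp hY).2
  rw [← hY2]

/-- the layer difference is dominated by the index distance. [formal bookkeeping] -/
theorem abs_snd_sub_le_dist (X Y : Cell 2 × ℤ) : |(((Y.2 - X.2 : ℤ)) : ℝ)| ≤ dist X Y := by
  rw [dist_eq_idxNorm, ← Int.cast_abs, ← Nat.cast_natAbs]
  exact_mod_cast natAbs_snd_le_idxNorm (Y - X)

/-- ★ THE CHAIN IS BANDED: in a `c`-co-Lipschitz crystal the block from `X` to a layer farther than `ϱ / c` vanishes (no tameness needed). [this file, g57] -/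
theorem chainK_eq_zero_of_far (hc : 0 < c) (hL : IsLayeredCrystal c a b w) {ϱ : ℝ} {X : Cell 2 × ℤ} {β : ℤ}
    (h : ϱ < c * |(((β - X.2 : ℤ)) : ℝ)|) (u : E3) : chainK ϱ a b w X β u = 0 := by
  unfold chainK
  refine (finsum_congr fun γ' => ?_).trans finsum_zero
  refine nearK_eq_zero_of_lt (X := X) (Y := (γ', β)) (h.trans_le ?_) u
  calc c * |(((β - X.2 : ℤ)) : ℝ)| ≤ c * dist X (γ', β) := mul_le_mul_of_nonneg_left (abs_snd_sub_le_dist X (γ', β)) hc.le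
    _ = c * dist (γ', β) X := by rw [dist_comm]
    _ ≤ ‖lsite a b w γ' β - lsite a b w X.1 X.2‖ := hL (γ', β) X

/-! ### VI.3  Linearity and block symmetry -/

/-- the chain block is additive in its argument (co-Lipschitz crystal). [formal bookkeeping] -/
theorem chainK_add (hc : 0 < c) (hL : IsLayeredCrystal c a b w) (ϱ : ℝ) (X : Cell 2 × ℤ) (β : ℤ) (u v : E3) :
    chainK ϱ a b w X β (u + v) = chainK ϱ a b w X β u + chainK ϱ a b w X β v := by
  have hN : ∀ Y : Cell 2 × ℤ, ‖lsite a b w Y.1 Y.2 - lsite a b w X.1 X.2‖ ≤ ϱ → Y ∈ (finite_near_lsite hc hL X ϱ).toFinset :=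
    fun _ hY => (finite_near_lsite hc hL X ϱ).mem_toFinset.mpr hY
  simp only [chainK_eq_sum hN, nearK_add, sum_add_distrib]

/-- the chain block commutes with scalars (co-Lipschitz crystal). [formal bookkeeping] -/
theorem chainK_smul (hc : 0 < c) (hL : IsLayeredCrystal c a b w) (ϱ : ℝ) (X : Cell 2 × ℤ) (β : ℤ) (r : ℝ) (u : E3) :
    chainK ϱ a b w X β (r • u) = r • chainK ϱ a b w X β u := by
  have hN : ∀ Y : Cell 2 × ℤ, ‖lsite a b w Y.1 Y.2 - lsite a b w X.1 X.2‖ ≤ ϱ → Y ∈ (finite_near_lsite hc hL X ϱ).toFinset :=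
    fun _ hY => (finite_near_lsite hc hL X ϱ).mem_toFinset.mpr hY
  simp only [chainK_eq_sum hN, nearK_smul, smul_sum]

/-- ★ BLOCK SYMMETRY of the chain: the block from layer `α` to layer `β` equals the block from `β` to `α` (bond reversal `nearK_comm` + in-plane translation;
the laminate's chain operator is symmetric by blocks — each block is moreover self-adjoint, `inner_forceConst_comm`, part B). [this file, g57] -/
theorem chainK_swap (ϱ : ℝ) (a b : E3) (w : ℤ → E3) (γ γ' : Cell 2) (α β : ℤ) (u : E3) :
    chainK ϱ a b w (γ, α) β u = chainK ϱ a b w (γ', β) α u := by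
  rw [chainK_translate ϱ a b w γ, chainK_translate ϱ a b w γ']
  unfold chainK
  rw [← finsum_comp_equiv (Equiv.neg (Cell 2)) (f := fun δ : Cell 2 => nearK ϱ a b w (0, β) (δ, α) u)]
  refine finsum_congr fun δ => ?_
  rw [← nearK_comm ϱ a b w (0, α) (δ, β) u, nearK_translate]
  congr 2
  simp

/-! ### VI.4  Layer-only fields: the truncated residual IS the chain residual -/

/-- the finite LAYER WINDOW of a site: the layers met by its `ϱ`-near sites. [this file, g57] -/
def layerWindow (hc : 0 < c) (hL : IsLayeredCrystal c a b w) (ϱ : ℝ) (X : Cell 2 × ℤ) : Finset ℤ :=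
  (finite_near_lsite hc hL X ϱ).toFinset.image Prod.snd

/-- ★ for a LAYER-ONLY field `φ γ α = cf α` the truncated residual at `X` is the CHAIN RESIDUAL over the `β`-fibres of any finset containing the near sites.
[this file, g57] -/
theorem truncResidual_layerField_eq_sum {ϱ : ℝ} {X : Cell 2 × ℤ} {N : Finset (Cell 2 × ℤ)}
    (hN : ∀ Y : Cell 2 × ℤ, ‖lsite a b w Y.1 Y.2 - lsite a b w X.1 X.2‖ ≤ ϱ → Y ∈ N) (cf : ℤ → E3) :
    truncResidual ϱ a b w (fun _ α => cf α) X = ∑ β ∈ N.image Prod.snd, chainK ϱ a b w X β (cf β - cf X.2) := by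
  rw [truncResidual_eq_sum_nearK hN]
  simp only [chainK_eq_sum hN]
  rw [← sum_fiberwise_of_maps_to (s := N) (t := N.image Prod.snd) (g := Prod.snd) fun _ hY => mem_image_of_mem _ hY]
  refine sum_congr rfl fun β _ => sum_congr rfl fun Y hY => ?_
  rw [(mem_filter.mp hY).2]

/-- the same with the canonical layer window of a co-Lipschitz crystal. [this file, g57] -/
theorem truncResidual_layerField_eq (hc : 0 < c) (hL : IsLayeredCrystal c a b w) (ϱ : ℝ) (cf : ℤ → E3) (X : Cell 2 × ℤ) :
    truncResidual ϱ a b w (fun _ α => cf α) X = ∑ β ∈ layerWindow hc hL ϱ X, chainK ϱ a b w X β (cf β - cf X.2) :=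
  truncResidual_layerField_eq_sum (fun _ hY => (finite_near_lsite hc hL X ϱ).mem_toFinset.mpr hY) cf

/-- the layer window is in-plane translation invariant. [formal bookkeeping] -/
theorem layerWindow_translate (hc : 0 < c) (hL : IsLayeredCrystal c a b w) (ϱ : ℝ) (γ : Cell 2) (α : ℤ) :
    layerWindow hc hL ϱ (γ, α) = layerWindow hc hL ϱ (0, α) := by
  ext β
  rw [layerWindow, layerWindow, Finset.mem_image, Finset.mem_image]
  constructor
  · rintro ⟨Y, hY, rfl⟩
    refine ⟨(Y.1 - γ, Y.2), ?_, rfl⟩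
    rw [Set.Finite.mem_toFinset, Set.mem_setOf_eq] at hY ⊢
    rwa [← lsite_sub_translate a b w γ Y.1 α Y.2]
  · rintro ⟨Y, hY, rfl⟩
    refine ⟨(Y.1 + γ, Y.2), ?_, rfl⟩
    rw [Set.Finite.mem_toFinset, Set.mem_setOf_eq] at hY ⊢
    rwa [lsite_sub_translate a b w γ (Y.1 + γ) α Y.2, add_sub_cancel_right]

/-- ★ the truncated residual of a layer-only field is IN-PLANE CONSTANT (it is the chain residual of the layer). [this file, g57] -/
theorem truncResidual_layerField_translate (hc : 0 < c) (hL : IsLayeredCrystal c a b w) (ϱ : ℝ) (cf : ℤ → E3) (γ : Cell 2) (α : ℤ) :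
    truncResidual ϱ a b w (fun _ α => cf α) (γ, α) = truncResidual ϱ a b w (fun _ α => cf α) (0, α) := by
  rw [truncResidual_layerField_eq hc hL, truncResidual_layerField_eq hc hL, layerWindow_translate hc hL]
  exact sum_congr rfl fun β _ => chainK_translate ϱ a b w γ α β _

/-- ★ THE 1D CHAIN EQUATION: a layer-only field is `ϱ`-truncated-harmonic EVERYWHERE iff its profile `cf` solves, layer by layer,
`Σ_{β ∈ window(α)} chainK (0, α) β (cf β − cf α) = 0` — a banded (`chainK_eq_zero_of_far`) block-symmetric (`chainK_swap`) recursion. [this file, g57] -/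
theorem isTruncHarmonicZ_layerField_iff (hc : 0 < c) (hL : IsLayeredCrystal c a b w) (ϱ : ℝ) (cf : ℤ → E3) :
    IsTruncHarmonicZ ϱ a b w (fun _ α => cf α) Set.univ ↔
      ∀ α : ℤ, ∑ β ∈ layerWindow hc hL ϱ ((0 : Cell 2), α), chainK ϱ a b w ((0 : Cell 2), α) β (cf β - cf α) = 0 := by
  constructor
  · intro h α
    rw [← truncResidual_layerField_eq hc hL ϱ cf ((0 : Cell 2), α)]
    exact truncResidual_eq_zero_of_isTruncHarmonicZ h (Set.mem_univ _)
  · intro h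
    refine isTruncHarmonicZ_of_truncResidual_eq_zero hc hL fun X _ => ?_
    obtain ⟨γ, α⟩ := X
    rw [truncResidual_layerField_translate hc hL, truncResidual_layerField_eq hc hL]
    exact h α

/-! ### VI.5  In-plane cut-offs of layer-only fields: the ROW IDENTITY behind the coercivity transfer (b1) -/

/-- the layer profile `cf` cut off to the in-plane cell set `B`: `χ (γ, α) = cf α` for `γ ∈ B`, `0` outside (the test fields of brick (b1)). [this file, g57] -/
def cutProfile (B : Finset (Cell 2)) (cf : ℤ → E3) : Cell 2 → ℤ → E3 :=
  fun γ α => if γ ∈ B then cf α else 0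

/-- Evaluation of `cutProfile` inside the cut. [formal bookkeeping] -/
theorem cutProfile_of_mem {B : Finset (Cell 2)} (cf : ℤ → E3) {γ : Cell 2} (h : γ ∈ B) (α : ℤ) : cutProfile B cf γ α = cf α := by
  unfold cutProfile; rw [if_pos h]

/-- Evaluation of `cutProfile` outside the cut. [formal bookkeeping] -/
theorem cutProfile_of_not_mem {B : Finset (Cell 2)} (cf : ℤ → E3) {γ : Cell 2} (h : γ ∉ B) (α : ℤ) : cutProfile B cf γ α = 0 := by
  unfold cutProfile; rw [if_neg h]

/-- `cutProfile` vanishes off the cylinder `B × S` when `cf` vanishes off `S`. [formal bookkeeping] -/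
theorem cutProfile_eq_zero_of_not_mem {B : Finset (Cell 2)} {S : Finset ℤ} {cf : ℤ → E3} (hS : ∀ α, α ∉ S → cf α = 0)
    (X : Cell 2 × ℤ) (hX : X ∉ B ×ˢ S) : cutProfile B cf X.1 X.2 = 0 := by
  by_cases h : X.1 ∈ B
  · rw [cutProfile_of_mem cf h]
    exact hS X.2 fun h2 => hX (mem_product.mpr ⟨h, h2⟩)
  · exact cutProfile_of_not_mem cf h X.2

/-- ★ THE DEEP-ROW IDENTITY: at a site `p` of the cut whose `ϱ`-near sites all lie over the cut, the row of the truncated quadratic form of the cut field is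
the CHAIN ROW of the profile: `Σ_q ⟪χ q − χ p, nearK p q (χ q − χ p)⟫ = Σ_β ⟪cf β − cf p.2, chainK p β (cf β − cf p.2)⟫` (any finset `N` containing the
near sites indexes both sides).  With `chainK_translate` the right-hand side depends on the layer `p.2` only: deep rows contribute `#(deep cells) × (chain
form)` to `Q_ϱ(χ)` — the `O(L²)` term of the transfer. [this file, g57] -/
theorem row_nearFam_cutProfile_eq {ϱ : ℝ} {B : Finset (Cell 2)} (cf : ℤ → E3) {p : Cell 2 × ℤ} {N : Finset (Cell 2 × ℤ)}
    (hN : ∀ Y : Cell 2 × ℤ, ‖lsite a b w Y.1 Y.2 - lsite a b w p.1 p.2‖ ≤ ϱ → Y ∈ N)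
    (hB : ∀ Y : Cell 2 × ℤ, ‖lsite a b w Y.1 Y.2 - lsite a b w p.1 p.2‖ ≤ ϱ → Y.1 ∈ B) (hp : p.1 ∈ B) :
    ∑ q ∈ N, nearFam ϱ a b w (cutProfile B cf) (p, q) = ∑ β ∈ N.image Prod.snd, ⟪cf β - cf p.2, chainK ϱ a b w p β (cf β - cf p.2)⟫_ℝ := by
  have hR : ∑ β ∈ N.image Prod.snd, ⟪cf β - cf p.2, chainK ϱ a b w p β (cf β - cf p.2)⟫_ℝ
      = ∑ q ∈ N, ⟪cf q.2 - cf p.2, nearK ϱ a b w p q (cf q.2 - cf p.2)⟫_ℝ := by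
    simp only [chainK_eq_sum hN, inner_sum]
    rw [← sum_fiberwise_of_maps_to (s := N) (t := N.image Prod.snd) (g := Prod.snd) fun _ hY => mem_image_of_mem _ hY]
    refine sum_congr rfl fun β _ => sum_congr rfl fun Y hY => ?_
    rw [(mem_filter.mp hY).2]
  rw [hR]
  refine sum_congr rfl fun q _ => ?_
  unfold nearFam
  by_cases hq : ϱ < ‖lsite a b w q.1 q.2 - lsite a b w p.1 p.2‖
  · simp only [nearK_eq_zero_of_lt (X := p) (Y := q) hq, inner_zero_right]
  · simp only [cutProfile_of_mem cf hp, cutProfile_of_mem cf (hB q (not_lt.mp hq))]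

/-- FAR ROWS VANISH: at a site outside the cut none of whose `ϱ`-near sites lies over the cut, every summand of the row is zero. [this file, g57] -/
theorem nearFam_cutProfile_eq_zero {ϱ : ℝ} {B : Finset (Cell 2)} (cf : ℤ → E3) {p : Cell 2 × ℤ}
    (hB : ∀ Y : Cell 2 × ℤ, ‖lsite a b w Y.1 Y.2 - lsite a b w p.1 p.2‖ ≤ ϱ → Y.1 ∉ B) (hp : p.1 ∉ B) (q : Cell 2 × ℤ) :
    nearFam ϱ a b w (cutProfile B cf) (p, q) = 0 := by
  unfold nearFam
  by_cases hq : ϱ < ‖lsite a b w q.1 q.2 - lsite a b w p.1 p.2‖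
  · simp only [nearK_eq_zero_of_lt (X := p) (Y := q) hq, inner_zero_right]
  · simp only [cutProfile_of_not_mem cf hp, cutProfile_of_not_mem cf (hB q (not_lt.mp hq)), sub_zero, inner_zero_left]

/-- EVERY ROW IS BOUNDED BY THE KERNEL ROW-SUM: `|Σ_q nearFam χ (p, q)| ≤ Σ_q ‖nearK p q (χ q − χ p)‖ · ‖χ q − χ p‖` (Cauchy–Schwarz; the collar rows of the
transfer are bounded through it — the `O(L)` term). [formal bookkeeping] -/
theorem abs_row_nearFam_le {ϱ : ℝ} (χ : Cell 2 → ℤ → E3) (p : Cell 2 × ℤ) (N : Finset (Cell 2 × ℤ)) :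
    |∑ q ∈ N, nearFam ϱ a b w χ (p, q)| ≤ ∑ q ∈ N, ‖nearK ϱ a b w p q (χ q.1 q.2 - χ p.1 p.2)‖ * ‖χ q.1 q.2 - χ p.1 p.2‖ := by
  refine (abs_sum_le_sum_abs _ _).trans (sum_le_sum fun q _ => ?_)
  unfold nearFam
  rw [mul_comm]
  exact abs_real_inner_le_norm _ _

end ChainBlock

end Summit.AtomisticToContinuum.Crystallization.Theorems.ChartedZeroExcessLayeredLatticeLiouville
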